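import Summits.QuantumFields.YangMills.Theses.AllWindowsColdBox
import Summits.QuantumFields.YangMills.Theorems.AllWindowsColdBoxBoxWindowOfDominationRel
import Summits.QuantumFields.YangMills.Theorems.AllWindowsColdBoxBoxHighLineBulkCurrency
import Summits.QuantumFields.YangMills.Theorems.WeakCouplingRatesDefs
import Literature.MathematicalPhysics.QuantumLattice.LatticeGaugeDLR

/-!
# LINE-19 (v13 = v12 with S5's WINDOW RE-CUT `θL < 1/12 ↦ θL < 5/64` — rarity-entropy constraint ε₁ > 2θ flagged by w2 g31 2026-08-29T20:56:58Z, planner ym-idea-2 g18 ruling (α) 21:2xZ; 1/13 < 5/64, so both skeleton theorems are unchanged in content; v12 = v11 with S5's CONCLUSION RE-CUT to the BULK target `LandauRelativeComparisonBulk θL` — comparison at separations `L ≤ T ≤ H/M` (planner ym-idea-2 g18, 2026-08-29T18:35Z; the only consumer ✓p706506 evaluates at `T = ⌈β^A⌉₊`, `A < θ`, so the wall layer `T ≈ H` was never needed and is out of reach at second order); the bulk currency `RelativeCurrencyBulk` is a TREE THEOREM (`Theorems/AllWindowsColdBoxBoxHighLineBulkCurrency.lean`, `boxWindow_of_dirichletDominationBulk_ceiling`,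 filed by w5 p738430 from `Cruxes/BoxHighWindowsSU22/BulkCurrency.lean` 100289d6413b); every other stub text (S1–S4b, S6) byte-identical to v11; v11 = v10 with the S4b Prop renamed `LandauBootstrapBound`)
on ⟨stmt-QuantumFields-24004⟩ `AllWindowsColdBox.BoxHighWindowsSU22` (route L2 `route-QuantumFields-AllWindowsColdBox`, DRAFT by design).
Author ym-idea-2 g15 (technique card «open-question harvest 2023–2026» + lens `transfer` at crux level); crux idea «landau-sector-relative-bl»
= critic idea-crit-4 PASS 2026-08-29T08:05:05Z (notes N1–N3 built in below).  HONESTY: no summit, rung or item is proved by this file; ⟨24004⟩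
stays OPEN; the line's deliverable is the LOW sub-window (1/16, 1/13]; the HIGH sub-window is a DECLARED RESIDUAL (S6).

* WHY THIS LINE. The forest (axial) gauge of the proved one-scale engine prices the second-order remainder at H⁶/β (variances ≍ H,
  Poincaré ≍ H³) ⇒ θ ≤ 1/16.  The minimal Landau/Hodge sector (precision `hodgeQ = λλᵀ + Σ_{x int} g_x g_xᵀ = Δ_D − Σ_{∂Λ} g gᵀ`) has O(1)
  variances and Poincaré c/H² (instrument I20/I20b: λ_min·H² = 2.13…5.17 for H = 2…8, diagonals 0.155–0.431 H-flat), while the gauge-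
  invariant main term is unchanged (K_forest = K_Hodge, ✓p707757); paid in the RELATIVE currency (✓p706506) the remainder H⁴(log H)^m/β
  against the T⁻⁸ main term gives every window θ ≤ θL < 1/12 (rung k = 2); filed at θL = 1/13.
* WHY NOVEL vs the listed routes: L2's own items and LINE-17/18 work in the forest gauge with absolute currency; LogConcaveChart (δ absolute ⇒
  1/16), ConvexGribovBody (dormant; Brascamp–Lieb on the Gribov body at fixed volume, no window), MomentDuality / SixPlane / Hankel lines do not
  change the gauge sector; no route in `ledger route ls --problem QuantumFields` uses the relative currency + Hodge precision pair.
* BEARS ON: LADDER-YM rung «cold-box windows» (route L2 item ⟨24004⟩, child of ⟨22910⟩ BoxAllWindowsSU22 → XiSuperPolySU2 ⟨22804⟩).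
* CHEAPEST FALSIFIER: S1 at small H by exact linear algebra (λ_min(hodgeQ)·H² bounded below — I20b: SUPPORT through H = 8); the k = 2 power
  count 12θ < 1 is arithmetic.  Before any rung k ≥ 3 (θL ≥ 1/12) is staffed: the colour-vanishing instrument (exact order-β⁻¹ coefficient
  c₁(H,T), T ≤ H ≤ 8; KILL word «growth like H^a·T⁻²») under a frozen prereg (critic N2) — NOT needed for this k = 2 filing.
* INSTRUMENT ROWS of record: I20 (kit j327516) + I20b (j328356): (B) λ_min·H², (C) K_F = K_H, (D) Landau variances by stratum, (E) D2 decay —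
  all SUPPORT (HOME ideators/ym-idea-2/l23/I20-RESULTS.md); the row that would refute S3 is (E) D2 growing with H (KILL-E: > 4× at H = 8).

Skeleton shape (CRUX-PLAN (A), v9 = v10): seven registered stubs (six of the line, S1–S4, S4b, S5, + the declared residual S6) `stub_*` (sorry ONLY there);
the hypothesis-carrying compositions `boxWindowLowSU22_of` (stubs ⟹ the low child `BoxWindowLowSU22 θL` for every θL < 5/64 (v13; was 1/12)),
`BoxWindowLowSU2213_of` (six Landau stub statements ⟹ `LowGoal` := the ROUTE ITEM ⟨stmt-QuantumFields-24335⟩), `boxHighWindowsSU22_of_split`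
(low child ∧ high child ⟹ `CruxGoal` := the crux) and `BoxHighWindowsSU22_of` (seven stub statements ⟹ `CruxGoal`, θL = 1/13, parameter-free);
and the two by-name SKELETON THEOREMS `BoxWindowLowSU2213_proof : …Theses.AllWindowsColdBox.BoxWindowLowSU2213` and
`BoxHighWindowsSU22_proof : …Theses.AllWindowsColdBox.BoxHighWindowsSU22` (no hypotheses; assembled from the stubs).
-/

set_option autoImplicit false

noncomputable section

open MeasureTheory Matrix
open Literature.MathematicalPhysics.QuantumFieldTheory
open Literature.MathematicalPhysics.QuantumFieldTheory.LatticeMaxwell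
open Literature.MathematicalPhysics.QuantumFieldTheory.AxialGauge
open Summit.QuantumFields.YangMills.Theorems.WeakCouplingRates

namespace Summit.QuantumFields.YangMills.Cruxes.BoxHighWindowsSU22.LandauSectorRelativeBL

/-! ## Landau / Hodge objects of the cold box (as in `Sketch.lean`) -/

/-- Landau pinning predicate: an edge is pinned iff it is NOT an edge of the cold box (no gauge forest). -/
def landauPin (H : ℕ) : Literature.MathematicalPhysics.QuantumLattice.ZdEdge 4 → Prop := fun e => e ∉ boxEdges 4 (2 * H + 1)

instance (H : ℕ) : DecidablePred (landauPin H) := fun e => by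
  unfold landauPin; infer_instance

/-- All edges of the cold box as free variables inside the enlarged block. -/
abbrev LandauFree (H : ℕ) : Type := LatticeMaxwell.Free (landauPin H) dirCorner (2 * H + 3)

/-- Interior sites of `{0,…,2H}⁴` (all coordinates in `[1, 2H−1]`): the support of admissible gauge transformations. -/
def interiorSites (H : ℕ) : Finset (Literature.Probability.LatticeModels.Site 4) :=
  Fintype.piFinset fun _ => Finset.Icc (1 : ℤ) (2 * (H : ℤ) - 1)

/-- Gauge-mode (lattice gradient) vector of the site `x` on the free edges. -/
def gradVec (H : ℕ) (x : Literature.Probability.LatticeModels.Site 4) : LandauFree H → ℝ := fun e =>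
  (if e.1.1.1 + Pi.single e.1.1.2 1 = x then (1 : ℝ) else 0) - (if e.1.1.1 = x then (1 : ℝ) else 0)

/-- Hodge precision matrix `Q_L + Σ_{x interior} g_x g_xᵀ` (`= d₁ᵀd₁ + d₀d₀ᵀ`). -/
def hodgeQ (H : ℕ) : Matrix (LandauFree H) (LandauFree H) ℝ :=
  Qmat (landauPin H) dirCorner (2 * H + 3) + ∑ x ∈ interiorSites H, vecMulVec (gradVec H x) (gradVec H x)

/-- Circulation coefficient vector of a plaquette on the Landau free edges. -/
def landauCoeff (H : ℕ) (p : Plaq 4) : LandauFree H → ℝ := coeff (landauPin H) dirCorner (2 * H + 3) p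

/-- S1 statement: Hodge–Poincaré, `λ_min(hodgeQ H) ≥ c/H²`. -/
def HodgePoincareColdBox : Prop :=
  ∃ c : ℝ, 0 < c ∧ ∀ H : ℕ, 1 ≤ H → ∀ v : LandauFree H → ℝ, c / (H : ℝ) ^ 2 * (v ⬝ᵥ v) ≤ v ⬝ᵥ (hodgeQ H *ᵥ v)

/-- S2 statement: the forest-gauge projection kernel is the Hodge kernel (gauge change). -/
def DirProjKernelHodgeForm : Prop :=
  ∀ H : ℕ, 1 ≤ H → ∀ p q : Plaq 4, boxDirProjKernel H p q = landauCoeff H p ⬝ᵥ ((hodgeQ H)⁻¹ *ᵥ landauCoeff H q)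

/-- S3a statement: bounded Landau variances (walls and corners included). -/
def LandauVarianceBounded : Prop :=
  ∃ C : ℝ, ∀ H : ℕ, 1 ≤ H → ∀ e : LandauFree H, (hodgeQ H)⁻¹ e e ≤ C

/-- S3b statement: Coulomb decay of the Landau kernel, `|G_ee'| ≤ C(1+log H)/(1+d)²`. -/
def LandauKernelDecay : Prop :=
  ∃ C : ℝ, ∀ H : ℕ, 1 ≤ H → ∀ e e' : LandauFree H,
    |(hodgeQ H)⁻¹ e e'| ≤ C * (1 + Real.log H) / (1 + (⨆ k : Fin 4, |((e.1.1.1 k - e'.1.1.1 k : ℤ) : ℝ)|)) ^ 2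

/-! ## The reduction event (O1 + O3 + O4) and the comparison (O2 + O5), typed over the YM box state -/

/-- `SU(2)`. -/
abbrev SU2 : Type := Matrix.specialUnitaryGroup (Fin 2) ℂ

/-- Gauge transformations supported on the interior sites (identity on the boundary and outside: they fix the frozen walls). -/
def IsInteriorGauge (H : ℕ) (g : Literature.Probability.LatticeModels.Site 4 → SU2) : Prop :=
  ∀ x, x ∉ interiorSites H → g x = 1

/-- Link defect `2 − Re tr U_e = ½‖U_e − 1‖_F²` (no norm instance needed). -/
def linkDefect (U : Literature.MathematicalPhysics.QuantumLattice.LGConfig 4 SU2)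
    (e : Literature.MathematicalPhysics.QuantumLattice.ZdEdge 4) : ℝ := 2 - ((U e : Matrix (Fin 2) (Fin 2) ℂ).trace).re

/-- The configuration is interior-gauge-equivalent to one whose box links all lie in the ball of (defect-)radius `r`. -/
def InGaugeBall (H : ℕ) (r : ℝ) (U : Literature.MathematicalPhysics.QuantumLattice.LGConfig 4 SU2) : Prop :=
  ∃ g : Literature.Probability.LatticeModels.Site 4 → SU2, IsInteriorGauge H g ∧
    ∀ e ∈ boxEdges 4 (2 * H + 1), linkDefect (Literature.MathematicalPhysics.QuantumLattice.gaugeTransformZd g U) e ≤ r ^ 2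

/-- Cold-wall configurations: every link outside the cube `[0,2H]⁴` is the identity (the support of `boxState`). -/
def ColdWall (H : ℕ) (U : Literature.MathematicalPhysics.QuantumLattice.LGConfig 4 SU2) : Prop :=
  ∀ e, e ∉ boxEdges 4 (2 * H + 1) → U e = 1

/-- The small-field event: every plaquette based in `[−1, 2H]⁴` has cost `2 − Re tr U_p ≤ s²`. -/
def SmallPlaquettes (H : ℕ) (s : ℝ) (U : Literature.MathematicalPhysics.QuantumLattice.LGConfig 4 SU2) : Prop :=
  ∀ x : Literature.Probability.LatticeModels.Site 4, (∀ k, -1 ≤ x k ∧ x k ≤ 2 * (H : ℤ)) → ∀ i j : Fin 4, i ≠ j →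
    plaqCostAt (G := SU2) (Literature.MathematicalPhysics.QuantumLattice.fundamentalRep (Fin 2)) x i j U ≤ s ^ 2

/-- Lattice LANDAU GAUGE at the interior sites (the stationarity condition of `g ↦ Σ_e linkDefect (U^g)_e` over interior gauge transforms;
for `SU(2)` the anti-Hermitian part `U − Uᴴ` is automatically traceless): `Σ_μ (A_{x,μ} − A_{x−μ,μ}) = 0` with `A_e := U_e − U_eᴴ`. -/
def InLandauGauge (H : ℕ) (U : Literature.MathematicalPhysics.QuantumLattice.LGConfig 4 SU2) : Prop :=
  ∀ x ∈ interiorSites H,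
    (∑ μ : Fin 4, ((U (x, μ) : Matrix (Fin 2) (Fin 2) ℂ) - (U (x, μ) : Matrix (Fin 2) (Fin 2) ℂ)ᴴ)) =
      ∑ μ : Fin 4, ((U (x - Pi.single μ 1, μ) : Matrix (Fin 2) (Fin 2) ℂ) - (U (x - Pi.single μ 1, μ) : Matrix (Fin 2) (Fin 2) ℂ)ᴴ)

/-- S4b statement **(small Landau representative = discrete Uhlenbeck gauge fixing up to the cold wall; M since v10, was L)**: on the
small-field event with `s·H⁴·(1+log H)² ≤ c₀` some interior gauge transform puts `U` in lattice Landau gauge with ALL box links within defect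
`C·H²(1+log H)⁴·s²` of the identity.  v10 TYPING (2026-08-29T12:15Z; v5–v9 had premise `s·H³(1+log H)` and conclusion `(1+log H)²`, priced on a
continuity/Newton inversion of the FP operator along a path): the ONE-STEP BOOTSTRAP from the CHECKED Stage-I crude bound closes S4b with NO
continuity method — the minimiser of the Landau functional over interior gauges exists, is in lattice Landau gauge and has TOTAL defect
`L' ≤ 72900·H⁸·s²` (kit `H4b0abc-LandauStageI-DRAFT.lean`, `landauMin_le_forest`); in Landau gauge the su(2)-parts `a_e ∈ ℝ³` of the links obey the
EXACT linear identity `a = Σ_p (hodgeQ⁻¹ d₁ᵀ)_{·,p} (da)(p)` (`d₀ᵀ a = 0` at interior sites IS `InLandauGauge`; S1 gives invertibility), and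
`(da)(p) = vec(hol_p) + O(M·Σ_{e∈p}|a_e|)` (quaternion algebra, `M := max_e |a_e| ≤ 1/2`), so with the row sum `K = Σ_p |∇G| ≤ C·H(1+log H)`
(H4b.1 = H4b.1′ + the PROVED shell sum), the ℓ²-row `K₂ = (Σ_p |∇G|²)^{1/2} ≤ C(1+log H)` and Cauchy–Schwarz (`Σ_p (Σ_{e∈p}|a_e|)² ≤ 24·Σ|a|² ≤ 24 L'`):
`M ≤ K·s + C₁·K₂·√(24 L')·M`, and the premise makes the coefficient of `M` at most `1/2`, whence `M ≤ 2Ks`, defect `≤ 2M² ≤ 8K²s²`.  The exponent 4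
costs NOTHING downstream: S4 ⇐ S4b (CHECKED, kit `S4-of-S4b-DRAFT.lean`, every θL < 1/12) and S5 apply S4b at the PLAQUETTE scale `s = β^(ε−1/2)`,
`ε = 2θ + o(1)`, where `s·H⁴·(log)² → 0` iff `θ < 1/12` — the line's window anyway; one spare log on each side (log-robustness rule, STUB-PLAN-S4b §7).
Sources: Bałaban 1985 (gauge fixing / Green's functions, `Balaban1985`, `Balaban1983RegularityDecay`), Uhlenbeck 1982 (continuum), Zwanziger 1982. -/
def LandauBootstrapBound : Prop :=
  ∃ C c₀ : ℝ, 0 < C ∧ 0 < c₀ ∧ ∀ H : ℕ, 1 ≤ H → ∀ s : ℝ, 0 ≤ s → s * (H : ℝ) ^ 4 * (1 + Real.log H) ^ 2 ≤ c₀ →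
    ∀ U : Literature.MathematicalPhysics.QuantumLattice.LGConfig 4 SU2, ColdWall H U → SmallPlaquettes H s U →
      ∃ g : Literature.Probability.LatticeModels.Site 4 → SU2, IsInteriorGauge H g ∧
        InLandauGauge H (Literature.MathematicalPhysics.QuantumLattice.gaugeTransformZd g U) ∧
        ∀ e ∈ boxEdges 4 (2 * H + 1),
          linkDefect (Literature.MathematicalPhysics.QuantumLattice.gaugeTransformZd g U) e ≤ C * (H : ℝ) ^ 2 * (1 + Real.log H) ^ 4 * s ^ 2

/-- S4 statement **(gauge-ball reduction; at the filed θL = 1/13 an M-sized lemma)**: at scale `H = ⌈β^θ⌉`, `θ ≤ θL`, the cold-box state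
gives mass `≤ exp(−β^κ)` to configurations NOT interior-gauge-equivalent to one whose box links all have defect `≤ β^{−1+2κ}`.
RARITY BUDGET (v7 correction, 2026-08-29T09:45Z): in the COLD-WALL BOX state the landed large-field rarity is the Gibbs union bound
`Theorems.ColdBoxAllGroupsBoxFloorAllGroupsLargeFieldG.boxState_largeField_rarity_of_rep` — `boxState{∃ p, plaqCost_p ≥ β^{2ε−1}} ≤ exp(−β^ε)`
ONLY for ε > 2θ (the free-δ per-plaquette rarity `plaquetteLargeFieldRarity_eventually` is a TORUS chessboard estimate and does not transfer
to the flat datum).  Hence the small-plaquette scale is s = β^{−1/2+ε} with ε > 2θ, NOT a free κ'.  Two proof routes and their honest ranges: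
(a) FOREST (comb) gauge rooted at the cold wall + non-abelian Stokes (`linkDefect ≤ (2H²+2H)²·max_p plaqCost_p`): radius exponent κ > 2θ + ε >
4θ; with the S5 interlock κ < 1/2 − 3θL this closes iff θL < 1/14 — NOT enough for the filed 1/13;  (b) via S4b (the small LANDAU representative
on `SmallPlaquettes H s`: deviation ≤ C·H(1+log H)·s): κ > θ + ε > 3θ, closing iff θL < 1/12 ✓ (1/13 included; S4b's premise
s·H³(1+log H) ≤ c₀ ⇔ 3θ + ε < 1/2 ⇔ θ < 1/10 ✓).  So S4 is stated for θL < 1/12 and is M-sized GIVEN S4b (route (b)); route (a) alone is a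
1/14-lemma.  (Tail exponent κ₂ decoupled from κ as before.)  S4 is very plausibly TRUE for every θL (Landau-gauge links are O(β^{−1/2}√log)
w.h.p.), but beyond 1/12 its proof is the line's own content (S4⁺ = Landau-gauge concentration, `ConvexGribovBody.BrascampLiebVacuumSC`
⟨16404⟩) — not filed. -/
def GaugeBallReduction (θL κ : ℝ) : Prop :=
  ∃ κ₂ : ℝ, 0 < κ₂ ∧ ∀ θ : ℝ, 0 < θ → θ ≤ θL → ∃ β₀ : ℝ, ∀ β : ℝ, β₀ ≤ β →
    boxState (Literature.MathematicalPhysics.QuantumLattice.fundamentalRep (Fin 2)) β ⌈β ^ θ⌉₊ {U | ¬ InGaugeBall ⌈β ^ θ⌉₊ (β ^ (-(1 : ℝ) / 2 + κ)) U} ≤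
      ENNReal.ofReal (Real.exp (-(β ^ κ₂)))

/-- The Transfer target `C⁺(θL)`: RELATIVE Dirichlet comparison at all separations `T ≤ H` (the hypothesis of the proved currency lemma
`boxWindow_of_dirichletDominationRel_ceiling`, helper-2). -/
def LandauRelativeComparison (θL : ℝ) : Prop :=
  ∀ θ : ℝ, 0 < θ → θ ≤ θL → ∃ η : ℝ, 0 < η ∧ ∃ β₀ : ℝ, ∀ β : ℝ, β₀ ≤ β → ∀ T : ℕ, T ≤ ⌈β ^ θ⌉₊ →
    η * boxDirCircSqCov ⌈β ^ θ⌉₊ T ≤ β ^ 2 * boxPlaqCov (G := SU2) (Literature.MathematicalPhysics.QuantumLattice.fundamentalRep (Fin 2)) β ⌈β ^ θ⌉₊ T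

/-- The T-respecting currency (a TREE THEOREM since ✓p706506: `AllWindowsColdBox.boxWindow_of_dirichletDominationRel_ceiling`). -/
def RelativeCurrency : Prop :=
  ∀ θc : ℝ, LandauRelativeComparison θc →
    ∀ A θ : ℝ, 0 < A → A < θ → θ ≤ θc → ∃ c : ℝ, 0 < c ∧ BoxTwoPointDomination (G := SU2) (Literature.MathematicalPhysics.QuantumLattice.fundamentalRep (Fin 2)) A θ c

/-- **v12 — the BULK relative Dirichlet comparison `C⁺_bulk(θL)`** (S5's conclusion since the g18 re-cut; text = the tree's
`AllWindowsColdBoxBoxHighLine.LandauRelativeComparisonBulk` verbatim): comparison only at separations `L ≤ T` and `M·T ≤ H = ⌈β^θ⌉₊`. -/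
def LandauRelativeComparisonBulk (θL : ℝ) : Prop :=
  ∀ θ : ℝ, 0 < θ → θ ≤ θL → ∃ M L η β₀ : ℝ, 1 ≤ M ∧ 0 < η ∧ ∀ β : ℝ, β₀ ≤ β → ∀ T : ℕ, L ≤ (T : ℝ) → M * (T : ℝ) ≤ (⌈β ^ θ⌉₊ : ℝ) →
    η * boxDirCircSqCov ⌈β ^ θ⌉₊ T ≤ β ^ 2 * boxPlaqCov (G := SU2) (Literature.MathematicalPhysics.QuantumLattice.fundamentalRep (Fin 2)) β ⌈β ^ θ⌉₊ T

/-- **v12 — the bulk currency** (a TREE THEOREM: `AllWindowsColdBoxBoxHighLine.boxWindow_of_dirichletDominationBulk_ceiling`; text verbatim). -/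
def RelativeCurrencyBulk : Prop :=
  ∀ θc : ℝ, LandauRelativeComparisonBulk θc →
    ∀ A θ : ℝ, 0 < A → A < θ → θ ≤ θc → ∃ c : ℝ, 0 < c ∧ BoxTwoPointDomination (G := SU2) (Literature.MathematicalPhysics.QuantumLattice.fundamentalRep (Fin 2)) A θ c

/-- The LOW CHILD of the proposed glued split of `BoxHighWindowsSU22`: windows with `1/16 < θ ≤ θL`. -/
def BoxWindowLowSU22 (θL : ℝ) : Prop :=
  ∀ A θ : ℝ, 0 < A → A < θ → θ ≤ 7 * A → 1 / 16 < θ → θ ≤ θL →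
    ∃ c : ℝ, 0 < c ∧ BoxTwoPointDomination (G := SU2) (Literature.MathematicalPhysics.QuantumLattice.fundamentalRep (Fin 2)) A θ c

/-- The HIGH CHILD (RG residual): windows with `θL < θ`. -/
def BoxWindowHighSU22 (θL : ℝ) : Prop :=
  ∀ A θ : ℝ, 0 < A → A < θ → θ ≤ 7 * A → θL < θ →
    ∃ c : ℝ, 0 < c ∧ BoxTwoPointDomination (G := SU2) (Literature.MathematicalPhysics.QuantumLattice.fundamentalRep (Fin 2)) A θ c

/-! ## Registered stubs (sorry ONLY here) -/

theorem stub_hodgePoincare : HodgePoincareColdBox := by sorry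

theorem stub_kernelHodgeForm : DirProjKernelHodgeForm := by sorry

theorem stub_landauKernelBounds : LandauVarianceBounded ∧ LandauKernelDecay := by sorry

/-- **S4 (gauge-ball reduction; M GIVEN S4b, θL < 1/12 — v7: range corrected from 1/10, see the def's docstring RARITY BUDGET).**
INTERLOCK with S5 (critic N3): κ must satisfy (a) κ > 0 and (b) `3θ + κ < 1/2` (uniform convexity / no Gribov copy inside the ball needs
`H³·β^{−1/2+κ} → 0`); with the landed box rarity (ε > 2θ) the Landau-representative route delivers any κ > 3θL, so the admissible set
is non-empty iff θL < 1/12 (at θL = 1/13: κ ∈ (3/13, 7/26) = (6/26, 7/26), non-empty).  The forest-only route would need θL < 1/14.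
v10: S4 is a COROLLARY of S4b — CHECKED kit `S4-of-S4b-DRAFT.lean`, `gaugeBallReduction_of_landauRepresentative : LandauBootstrapBound → ⟨this
signature⟩` with κ = 1/4 ∈ (3θL, 1/2 − 3θL), κ₂ = (1/4 − 3θL)/8, S4b applied at the plaquette scale `s = β^(2θ+κ₂−1/2)` on `coldGoodSet`
(tree `boxState_largeField_rarity`) + DLR properness (cold wall a.s.); it closes BY NAME the moment S4b lands. -/
theorem stub_gaugeBallReduction : ∀ θL : ℝ, θL < 1 / 12 → ∃ κ : ℝ, 0 < κ ∧ κ < 1 / 2 - 3 * θL ∧ GaugeBallReduction θL κ := by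
  sorry

/-- **S4b (small Landau representative; M since v10 — one-step bootstrap from the checked Stage I, see the def's docstring; obligations O1 + O3 of the card).** -/
theorem stub_landauRepresentative : LandauBootstrapBound := by sorry

/-- **S5 (O2 + O4 + O5, the analytic heart at rung k = 2; L–XL)**: on the gauge ball (S4's event, measure-exhausting) pass to the small
Landau representative (S4b; unique inside the ball since the FP operator is `≻ 0` there for `H³·β^{−1/2+κ} → 0`), FP/Haar change of variables,
and the second-order expansion around the Hodge Gaussian (precision `β·hodgeQ`, S1–S3) with remainder `H⁴(log H)^m/β` RELATIVE to the
`T⁻⁸` main term — closes `LandauRelativeComparison θL` for every `θL < 1/12`.  Gauge-INVARIANT conclusion (Elitzur): only `boxPlaqCov`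
and `boxDirCircSqCov` appear.  v10 NOTE: take the Landau representative at the PLAQUETTE scale — intersect with `coldGoodSet β ε H`
(`ε = 2θ + o(1)`, cost `exp(−β^ε)`, tree `boxState_largeField_rarity`) and apply S4b with `s = β^(ε−1/2)` (its premise `s·H⁴(1+log H)² ≤ c₀` holds
eventually iff θ < 1/12), exactly as the kit `S4-of-S4b-DRAFT.lean` does; the representative then has `|a_e| ≲ H(1+log H)²·β^(ε−1/2)`, far inside the ball.
v12 NOTE (g18 re-cut): the CONCLUSION is the BULK comparison `LandauRelativeComparisonBulk θL` (separations `L ≤ T ≤ H/M`, constants the prover's); the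
architecture of record is `Cruxes/BoxHighWindowsSU22/STUB-PLAN-S5-STEP2.md` (STEP 1 = T-S5.4J `OrbitNormaliserJacobianR`, STEP 2 = interpolation in the
all-edge chart around the Hodge Gaussian with fourth-moment remainder; every exponent constraint is `θ < 1/12`).
v13 NOTE (g18 WINDOW RE-CUT, 2026-08-29T21:2xZ): with the LANDED bricks the plaquette-rarity input of Step A is the free-threshold Gibbs union bound
✓`exists_boxState_largeField_le`, whose normaliser/entropy factor `(c·√β³)^{#Λ}`, `#Λ ≍ 32·H⁴`, forces `spl² β ≫ H⁴ log β`, i.e. `ε₁ > 2θ` (flag w2 g31);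
together with `ε₁ < 1/2 − 6θ + 2κ₃` (T-S5.6 exponent `C·r·H⁵ − c·β·s²`, `r ≥ r₀ = K·H(1+log H)²·β^(ε₁−1/2)`) and `κ₃ < (1/2 − 4θ)/3` (`sup_D |β V₃| ≤ 1`)
the parameter region is non-empty iff `θ < 5/64` (feasible point at θ = 1/13: (κ₃, ε₁) = (0.061, 0.157); ASSEMBLY-S5.md §1/§7 corrected).  Hence S5 is
stated for `θL < 5/64` — exactly what the assembly (`landauRelativeComparisonBulk_of_split`, ✓p744079) delivers and more than the route needs (θL = 1/13).
The natural second-order window `θ < 1/12` is RESTORABLE (lift L5 of U5-BLOCKERS.md: sharpen 6a to relative error `C·(t + t²H²)` and h6b via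
`‖M_H‖_op ≤ C log H` ⇒ T-S5.6′ exponent `C·(rH⁴ + r²H⁶ log) − cβs²`, feasible iff θ < min(5/58, 1/12) = 1/12) — not needed for ⟨24335⟩/⟨24004⟩. -/
theorem stub_landauSecondOrder : ∀ θL : ℝ, θL < 5 / 64 → HodgePoincareColdBox → DirProjKernelHodgeForm →
    LandauVarianceBounded ∧ LandauKernelDecay → LandauBootstrapBound →
    (∃ κ : ℝ, 0 < κ ∧ κ < 1 / 2 - 3 * θL ∧ GaugeBallReduction θL κ) →
    LandauRelativeComparisonBulk θL := by sorry

/-- **S6 — DECLARED RESIDUAL (critic N1): the HIGH sub-window `θ > 1/13` of the crux.**  NOT attacked by this line: it is the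
renormalisation-group regime (Bałaban class; the seat's HIGH-WINDOWS WALL memo of record, 2026-08-29T07:12Z).  Filed so that no reader
books LINE-19 as closing ⟨24004⟩: the line's honest deliverable is the LOW sub-window `(1/16, 1/13]` (stubs S1–S5), and the crux follows
only together with this residual.  TYPED AS THE ROUTE ITEM BY NAME: ⟨stmt-QuantumFields-24336⟩ =
`Summit.QuantumFields.YangMills.Theses.AllWindowsColdBox.BoxWindowHighSU2213` (route file rev 6, 2026-08-29T09:05Z; definitionally `BoxWindowHighSU22 (1/13)`). -/
theorem stub_boxWindowHigh13 : Summit.QuantumFields.YangMills.Theses.AllWindowsColdBox.BoxWindowHighSU2213 := by sorry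

/-- Not a stub: the currency is the landed helper ✓p706506. -/
theorem relativeCurrency : RelativeCurrency := fun θc h =>
  Summit.QuantumFields.YangMills.Theorems.AllWindowsColdBox.boxWindow_of_dirichletDominationRel_ceiling θc h

/-- Not a stub (v12): the BULK currency is the landed Theorems copy of `Cruxes/BoxHighWindowsSU22/BulkCurrency.lean` (texts identical, so `exact` unfolds). -/
theorem relativeCurrencyBulk : RelativeCurrencyBulk := fun θc h =>
  Summit.QuantumFields.YangMills.Theorems.AllWindowsColdBoxBoxHighLine.boxWindow_of_dirichletDominationBulk_ceiling θc h

/-! ## Kernel-checked compositions (no sorry)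

v9 SHAPE (the registered-skeleton invariant of `#h21_check_skeleton`, same shape as the registered LINE-17/18 skeletons): exactly ONE theorem
of this file concludes the crux `…Theses.AllWindowsColdBox.BoxHighWindowsSU22` BY NAME — `BoxHighWindowsSU22_proof`, with NO hypotheses,
assembled from the seven declared stubs (sorries live only inside `stub_*`); the hypothesis-carrying compositions `BoxHighWindowsSU22_of`,
`boxHighWindowsSU22_of_split`, `BoxWindowLowSU2213_of` conclude the local aliases `CruxGoal` / `LowGoal` (definitionally the route decls), and
`BoxWindowLowSU2213_proof` is the unique by-name theorem for the LOW item ⟨stmt-QuantumFields-24335⟩ (so the same file registers there too). -/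

/-- Local alias of the crux ⟨stmt-QuantumFields-24004⟩ (an `abbrev`: `BoxHighWindowsSU22_proof : <route decl> := BoxHighWindowsSU22_of …` by `rfl`-unfolding). -/
abbrev CruxGoal : Prop := Summit.QuantumFields.YangMills.Theses.AllWindowsColdBox.BoxHighWindowsSU22

/-- Local alias of the LOW item ⟨stmt-QuantumFields-24335⟩. -/
abbrev LowGoal : Prop := Summit.QuantumFields.YangMills.Theses.AllWindowsColdBox.BoxWindowLowSU2213

/-- stubs ⟹ the low child, for any `θL < 5/64` (v13: S5's rarity-entropy window, see S5's docstring; S4 keeps its range `θL < 1/12`; v12: via the BULK currency). -/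
theorem boxWindowLowSU22_of (θL : ℝ) (hθL : θL < 5 / 64)
    (h1 : HodgePoincareColdBox) (h2 : DirProjKernelHodgeForm) (h3 : LandauVarianceBounded ∧ LandauKernelDecay)
    (h4 : ∀ θL' : ℝ, θL' < 1 / 12 → ∃ κ : ℝ, 0 < κ ∧ κ < 1 / 2 - 3 * θL' ∧ GaugeBallReduction θL' κ)
    (h4b : LandauBootstrapBound)
    (h5 : ∀ θL' : ℝ, θL' < 5 / 64 → HodgePoincareColdBox → DirProjKernelHodgeForm →
      LandauVarianceBounded ∧ LandauKernelDecay → LandauBootstrapBound →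
      (∃ κ : ℝ, 0 < κ ∧ κ < 1 / 2 - 3 * θL' ∧ GaugeBallReduction θL' κ) → LandauRelativeComparisonBulk θL')
    (h6 : RelativeCurrencyBulk) : BoxWindowLowSU22 θL := by
  have hθL' : θL < 1 / 12 := lt_trans hθL (by norm_num)
  have hC : LandauRelativeComparisonBulk θL := h5 θL hθL h1 h2 h3 h4b (h4 θL hθL')
  intro A θ hA hAθ _h7 _h16 hθL'
  exact h6 θL hC A θ hA hAθ hθL'

/-- The glued split at a general θL: low child ∧ high child ⟹ the crux (as `CruxGoal`). -/
theorem boxHighWindowsSU22_of_split (θL : ℝ) (hlo : BoxWindowLowSU22 θL) (hhi : BoxWindowHighSU22 θL) : CruxGoal := by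
  intro A θ hA hAθ h7 h16
  by_cases hθ : θ ≤ θL
  · exact hlo A θ hA hAθ h7 h16 hθ
  · exact hhi A θ hA hAθ h7 (lt_of_not_ge hθ)

/-- The route item ⟨stmt-QuantumFields-24335⟩ `Summit.QuantumFields.YangMills.Theses.AllWindowsColdBox.BoxWindowLowSU2213` IS `BoxWindowLowSU22 (1/13)` (by `Iff.rfl`). -/
theorem boxWindowLowSU2213_iff : LowGoal ↔ BoxWindowLowSU22 (1 / 13) := Iff.rfl

/-- The route item ⟨stmt-QuantumFields-24336⟩ `Summit.QuantumFields.YangMills.Theses.AllWindowsColdBox.BoxWindowHighSU2213` IS `BoxWindowHighSU22 (1/13)` (by `Iff.rfl`). -/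
theorem boxWindowHighSU2213_iff : Summit.QuantumFields.YangMills.Theses.AllWindowsColdBox.BoxWindowHighSU2213 ↔ BoxWindowHighSU22 (1 / 13) := Iff.rfl

/-- **Composition for LINE-19's honest deliverable** (hypotheses = exactly the six Landau stub statements S1 S2 S3 S4 S4b S5, in order):
the LOW sub-window `1/16 < θ ≤ 1/13` = route item ⟨stmt-QuantumFields-24335⟩ (as `LowGoal`).  No residual is used here. -/
theorem BoxWindowLowSU2213_of :
    HodgePoincareColdBox → DirProjKernelHodgeForm → (LandauVarianceBounded ∧ LandauKernelDecay) →
    (∀ θL : ℝ, θL < 1 / 12 → ∃ κ : ℝ, 0 < κ ∧ κ < 1 / 2 - 3 * θL ∧ GaugeBallReduction θL κ) →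
    LandauBootstrapBound →
    (∀ θL : ℝ, θL < 5 / 64 → HodgePoincareColdBox → DirProjKernelHodgeForm →
      LandauVarianceBounded ∧ LandauKernelDecay → LandauBootstrapBound →
      (∃ κ : ℝ, 0 < κ ∧ κ < 1 / 2 - 3 * θL ∧ GaugeBallReduction θL κ) → LandauRelativeComparisonBulk θL) →
    LowGoal :=
  fun h1 h2 h3 h4 h4b h5 => boxWindowLowSU22_of (1 / 13) (by norm_num) h1 h2 h3 h4 h4b h5 relativeCurrencyBulk

/-- **Composition for the crux** (hypotheses = exactly the seven stub statements S1 S2 S3 S4 S4b S5 S6, in order): at the filed split point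
θL = 1/13 (< 5/64 < 1/12) the six Landau stubs + the landed currency give the LOW child, and the case split `θ ≤ 1/13 ∨ 1/13 < θ` with the
declared residual S6 (= route item ⟨stmt-QuantumFields-24336⟩ BY NAME) gives the crux (as `CruxGoal`). -/
theorem BoxHighWindowsSU22_of :
    HodgePoincareColdBox → DirProjKernelHodgeForm → (LandauVarianceBounded ∧ LandauKernelDecay) →
    (∀ θL : ℝ, θL < 1 / 12 → ∃ κ : ℝ, 0 < κ ∧ κ < 1 / 2 - 3 * θL ∧ GaugeBallReduction θL κ) →
    LandauBootstrapBound →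
    (∀ θL : ℝ, θL < 5 / 64 → HodgePoincareColdBox → DirProjKernelHodgeForm →
      LandauVarianceBounded ∧ LandauKernelDecay → LandauBootstrapBound →
      (∃ κ : ℝ, 0 < κ ∧ κ < 1 / 2 - 3 * θL ∧ GaugeBallReduction θL κ) → LandauRelativeComparisonBulk θL) →
    Summit.QuantumFields.YangMills.Theses.AllWindowsColdBox.BoxWindowHighSU2213 →
    CruxGoal :=
  fun h1 h2 h3 h4 h4b h5 hhi =>
    boxHighWindowsSU22_of_split (1 / 13) (boxWindowLowSU22_of (1 / 13) (by norm_num) h1 h2 h3 h4 h4b h5 relativeCurrencyBulk) hhi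

/-- **THE SKELETON THEOREM for ⟨stmt-QuantumFields-24335⟩** (the unique theorem of this file concluding the LOW item BY NAME; no hypotheses;
`sorry` only inside the six Landau stubs it is assembled from). -/
theorem BoxWindowLowSU2213_proof : Summit.QuantumFields.YangMills.Theses.AllWindowsColdBox.BoxWindowLowSU2213 :=
  BoxWindowLowSU2213_of stub_hodgePoincare stub_kernelHodgeForm stub_landauKernelBounds stub_gaugeBallReduction
    stub_landauRepresentative stub_landauSecondOrder

/-- **THE SKELETON THEOREM for the crux ⟨stmt-QuantumFields-24004⟩** (the unique theorem of this file concluding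
`Summit.QuantumFields.YangMills.Theses.AllWindowsColdBox.BoxHighWindowsSU22` BY NAME; no hypotheses; `sorry` only inside the seven declared
stubs it is assembled from — S1 S2 S3 S4 S4b S5 + the declared residual S6). -/
theorem BoxHighWindowsSU22_proof : Summit.QuantumFields.YangMills.Theses.AllWindowsColdBox.BoxHighWindowsSU22 :=
  BoxHighWindowsSU22_of stub_hodgePoincare stub_kernelHodgeForm stub_landauKernelBounds stub_gaugeBallReduction
    stub_landauRepresentative stub_landauSecondOrder stub_boxWindowHigh13

end Summit.QuantumFields.YangMills.Cruxes.BoxHighWindowsSU22.LandauSectorRelativeBL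

end
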